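import Summits.Ventures.PercRepro.Night2LocalD3ThreeTwoD

/-!
# PercRepro — the cell `(a, k) = (2, 2)` at `|E ∖ G| = 3`, `q = 4`: structure (night-2, gen 13)

`M|G` has two coloops `K = {y₁, y₂}`; at a far set `S` with `coloops S = K` the non-coloops `S' = S ∖ K` span the plane
`G ∖ K` without coloops.  This file records the structure behind `proofs/NIGHT-2-dq3.md` §5.3:

* the `K`-deletions of a covering set are layer-0 (`mem_lay0_of_erase_mem_K`), so the layer-1 preimages of a covering set
  `S''` inject into `coloops S'' ∖ K` (`card_nonLay0_preimages_le`);
* a nonzero loss needs two layer-1 preimages (`two_le_card_nonLay0_of_loss_ne_zero`: `2/5 ≤ capS < L₁ ≤ #·(6/25)`), hence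
  `≥ 4` coloops of the covering set, which is then a five-element set: every far set with a nonzero layer-2 weight has six
  elements (`card_eq_six_of_loss_ne_zero`, `card_eq_six_of_mem_ex2'`), for every coloop count;
* `not_mem_Uq_of_sdiff_subset_clF`: for a member `B ⊇ K` and `B' ⊇ K` with `G ∖ B' ⊆ cl B`, `B' ∉ U_G` (`ρ(G ∖ B') ≤ ρ(B) − |K| = 2`);
* at `coloops S = K`, `|S| = 6`: the members carrying weight are the PAIR MEMBERS `S ∖ P` (`P ⊆ S'` a pair); at most one pair member
  is FAT (`|G ∖ cl B| = 2`, `not_two_fat_pairs`): complementary pairs cannot both be members, and two pairs through a common point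
  put a point of `G ∖ S` into `cl(K ∪ {s})`.
-/

open scoped Matroid

namespace PercRepro.Shadow

open Finset PerFlat ThmH

variable {α : Type*} [DecidableEq α] {M : Matroid α} [M.Finite]

section TwoTwoA

variable {G S : Finset α}

open scoped Classical in
/-- **A `K`-deletion of a covering set is layer-0**: for `z ∈ K` (a coloop of `M|G`) and a shadow set `S''` with closure `G`,
the member `S'' ∖ z` has `cl(S'' ∖ z) = G ∖ z`. -/
theorem mem_lay0_of_erase_mem_K (hG : G ∈ flatsQ M (4 + 1)) (hd : (gr M \ G).card = 3) {S'' : Finset α}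
    (hS'' : S'' ∈ shadowAt M (4 + 2) 4 (Uq M (4 + 2) 4) G) {z : α}
    (hzK : z ∈ G.filter (fun y => y ∉ clF M (G.erase y)))
    (hB : S''.erase z ∈ membersIn M (Uq M (4 + 2) 4) G) : S''.erase z ∈ lay0 M 4 G := by
  have hGg : G ⊆ gr M := (mem_flatsQ.1 hG).1
  have hSG : S'' ⊆ G := subset_of_mem_shadowAt hS''
  have hBU : S''.erase z ∈ Uq M (4 + 2) 4 := (mem_membersIn.1 hB).1
  rw [mem_lay0]
  refine ⟨hB, ?_, by omega⟩
  have hzG : z ∈ G := (Finset.mem_filter.1 hzK).1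
  have hzcl : z ∉ clF M (G.erase z) := (Finset.mem_filter.1 hzK).2
  have hzcolG : z ∈ coloops M G := Finset.mem_filter.2 ⟨hzG, hzcl⟩
  have hrGz : rkN M (G.erase z) = 4 := by
    have := rkN_erase_of_mem_coloops hGg hzcolG
    have hGr : rkN M G = 4 + 1 := by
      have h := (mem_flatsQ.1 hG).2.2
      rw [eRk_eq_rkN] at h
      exact_mod_cast h
    omega
  have hrB : rkN M (S''.erase z) = 4 := by
    have h := (mem_Uq.1 hBU).2.1
    rw [eRk_eq_rkN] at h
    exact_mod_cast h
  have hBsub : S''.erase z ⊆ G.erase z := Finset.erase_subset_erase z hSG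
  have hGz : G.erase z ⊆ clF M (S''.erase z) := by
    have h := subset_closure_of_rkN_eq ((Finset.erase_subset z G).trans hGg) hBsub (by omega)
    intro e he
    rw [← Finset.mem_coe, coe_clF]
    exact h (by exact_mod_cast he)
  have hGsub : G \ clF M (S''.erase z) ⊆ {z} := by
    intro e he
    rw [Finset.mem_sdiff] at he
    rw [Finset.mem_singleton]
    by_contra hne
    exact he.2 (hGz (Finset.mem_erase.2 ⟨hne, he.1⟩))
  have hzS : z ∈ S'' := coloops_subset_self S'' (coloopsG_subset_coloops hS'' hzK)
  have hzin : z ∈ G \ clF M (S''.erase z) :=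
    Finset.mem_sdiff.2 ⟨hzG, (mem_coloops.1 (coloopsG_subset_coloops hS'' hzK)).2⟩
  have h1 : (G \ clF M (S''.erase z)).card ≤ 1 := (Finset.card_le_card hGsub).trans (by simp)
  have h2 : 1 ≤ (G \ clF M (S''.erase z)).card := Finset.card_pos.2 ⟨z, hzin⟩
  omega

open scoped Classical in
/-- **The layer-1 preimages of a covering set inject into its coloops outside `K`.** -/
theorem card_nonLay0_preimages_le (hG : G ∈ flatsQ M (4 + 1)) (hd : (gr M \ G).card = 3) {S'' : Finset α}
    (hS'' : S'' ∈ shadowAt M (4 + 2) 4 (Uq M (4 + 2) 4) G) :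
    ((coverPreimages M (Uq M (4 + 2) 4) G S'').filter (fun B => B ∉ lay0 M 4 G)).card ≤
      (coloops M S'' \ G.filter (fun y => y ∉ clF M (G.erase y))).card := by
  have key : ∀ B ∈ (coverPreimages M (Uq M (4 + 2) 4) G S'').filter (fun B => B ∉ lay0 M 4 G),
      ∃ z, B = S''.erase z ∧ z ∈ coloops M S'' \ G.filter (fun y => y ∉ clF M (G.erase y)) := by
    intro B hB
    rw [Finset.mem_filter, mem_coverPreimages, mem_coverSets] at hB
    obtain ⟨⟨hBm, z, hz, hzS⟩, hB0⟩ := hB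
    have hBU : B ∈ Uq M (4 + 2) 4 := (mem_membersIn.1 hBm).1
    have hzB : z ∉ B := fun h => (Finset.mem_sdiff.1 hz).2 (subset_clF hBU h)
    have hBeq : B = S''.erase z := by rw [← hzS, Finset.erase_insert hzB]
    refine ⟨z, hBeq, ?_⟩
    rw [Finset.mem_sdiff]
    constructor
    · rw [mem_coloops]
      refine ⟨by rw [← hzS]; exact Finset.mem_insert_self _ _, ?_⟩
      rw [← hBeq]
      exact (Finset.mem_sdiff.1 hz).2
    · intro hzK
      apply hB0
      rw [hBeq]
      exact mem_lay0_of_erase_mem_K hG hd hS'' hzK (hBeq ▸ hBm)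
  have hinj : Set.InjOn (fun B : Finset α => S'' \ B)
      ((coverPreimages M (Uq M (4 + 2) 4) G S'').filter (fun B => B ∉ lay0 M 4 G) : Set (Finset α)) := by
    intro B hB B' hB' hBB'
    obtain ⟨z, hz, -⟩ := key B hB
    obtain ⟨z', hz', -⟩ := key B' hB'
    have h1 : B ⊆ S'' := by rw [hz]; exact Finset.erase_subset _ _
    have h2 : B' ⊆ S'' := by rw [hz']; exact Finset.erase_subset _ _
    have h3 : S'' \ B = S'' \ B' := hBB'
    calc B = S'' \ (S'' \ B) := (Finset.sdiff_sdiff_eq_self h1).symm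
      _ = S'' \ (S'' \ B') := by rw [h3]
      _ = B' := Finset.sdiff_sdiff_eq_self h2
  rw [← Finset.card_image_of_injOn hinj]
  refine le_trans (Finset.card_le_card ?_) (Finset.card_image_le (f := fun y : α => ({y} : Finset α)))
  intro T hT
  rw [Finset.mem_image] at hT ⊢
  obtain ⟨B, hB, rfl⟩ := hT
  obtain ⟨z, hz, hzc⟩ := key B hB
  refine ⟨z, hzc, ?_⟩
  have hzS : z ∈ S'' := (mem_coloops.1 (Finset.mem_sdiff.1 hzc).1).1
  rw [hz, Finset.sdiff_erase hzS, Finset.sdiff_self, Finset.insert_empty]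

open scoped Classical in
/-- **A nonzero loss needs two layer-1 preimages** at `|E ∖ G| = 3`, `kColoops = 2`: `2/5 ≤ capS < L₁ ≤ #·(6/25)`. -/
theorem two_le_card_nonLay0_of_loss_ne_zero (hG : G ∈ flatsQ M (4 + 1)) (hd : (gr M \ G).card = 3)
    (hk : kColoops M G = 2) {B : Finset α} {z : α} (hzG : z ∈ G) (hBG : B ⊆ G) (hloss : loss M 4 G B z ≠ 0) :
    2 ≤ ((coverPreimages M (Uq M (4 + 2) 4) G (insert z B)).filter (fun B => B ∉ lay0 M 4 G)).card := by
  have hcap : 2 / 5 ≤ capS M 4 G (insert z B) := two_fifths_le_capS hd hk (Finset.insert_subset hzG hBG)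
  have hL : capS M 4 G (insert z B) < L1 M 4 G (insert z B) := by
    by_contra hle
    push Not at hle
    apply hloss
    unfold loss fS
    rw [if_pos hle]
    simp
  have hL1 := L1_le_card_mul hG hd (by norm_num) (insert z B)
  rw [phiQ_four_div_five] at hL1
  by_contra hlt
  push Not at hlt
  have : (((coverPreimages M (Uq M (4 + 2) 4) G (insert z B)).filter (fun B => B ∉ lay0 M 4 G)).card : ℚ) ≤ 1 := by
    exact_mod_cast Nat.lt_succ_iff.1 hlt
  linarith

open scoped Classical in
/-- **A covering set carrying a loss has five elements**: `≥ 4` coloops, so the non-coloops have rank `≤ 1`. -/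
theorem card_eq_five_of_loss_ne_zero (hs : ∀ e ∈ gr M, ∀ f ∈ gr M, e ≠ f → rkN M {e, f} = 2)
    (hl : ∀ e ∈ gr M, M.Indep {e}) (hG : G ∈ flatsQ M (4 + 1)) (hd : (gr M \ G).card = 3) (hk : kColoops M G = 2)
    {B : Finset α} (hBm : B ∈ membersIn M (Uq M (4 + 2) 4) G) {z : α} (hz : z ∈ G \ clF M B)
    (hloss : loss M 4 G B z ≠ 0) : (insert z B).card = 5 := by
  have hGg : G ⊆ gr M := (mem_flatsQ.1 hG).1
  have hBU : B ∈ Uq M (4 + 2) 4 := (mem_membersIn.1 hBm).1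
  have hBG : B ⊆ G := (subset_clF hBU).trans (mem_membersIn.1 hBm).2
  have hS'' : insert z B ∈ shadowAt M (4 + 2) 4 (Uq M (4 + 2) 4) G :=
    insert_mem_shadowAt (Finset.Subset.refl _) hG hBm hz
  have hSg : insert z B ⊆ gr M := (subset_of_mem_shadowAt hS'').trans hGg
  have h2 := two_le_card_nonLay0_of_loss_ne_zero hG hd hk (Finset.mem_sdiff.1 hz).1 hBG hloss
  have h3 := card_nonLay0_preimages_le hG hd hS''
  have hKsub : G.filter (fun y => y ∉ clF M (G.erase y)) ⊆ coloops M (insert z B) := coloopsG_subset_coloops hS''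
  have hKc : (G.filter (fun y => y ∉ clF M (G.erase y))).card = 2 := hk
  have h4 : 4 ≤ (coloops M (insert z B)).card := by
    have := Finset.card_sdiff_add_card_eq_card hKsub
    omega
  have hr := rkN_nonColoops_add hSg
  rw [rkN_eq_of_mem_shadowAt hS''] at hr
  have hN1 : rkN M (nonColoops M (insert z B)) ≤ 1 := by omega
  have hNc : (nonColoops M (insert z B)).card ≤ 1 := by
    apply card_le_one_of_eRk_le_one hs (Finset.sdiff_subset.trans hSg)
    rw [eRk_eq_rkN]
    exact_mod_cast hN1
  have hsplit := Finset.card_sdiff_add_card_eq_card (coloops_subset_self (M := M) (insert z B))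
  have hcol5 : (coloops M (insert z B)).card ≤ 5 :=
    card_coloops_le hSg (u := 5) (by rw [eRk_eq_rkN, rkN_eq_of_mem_shadowAt hS''])
  -- if the non-coloops are empty the coloops number `5`; otherwise `4` coloops and one non-coloop
  by_cases hN : (nonColoops M (insert z B)).card = 0
  · have hN' : rkN M (nonColoops M (insert z B)) = 0 := by
      rw [Finset.card_eq_zero] at hN
      rw [hN]; unfold rkN; simp
    unfold nonColoops at hsplit hN
    omega
  · have hN1' : (nonColoops M (insert z B)).card = 1 := by omega
    have hrN : rkN M (nonColoops M (insert z B)) = 1 := by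
      obtain ⟨e, he⟩ := Finset.card_eq_one.1 hN1'
      have heN : e ∈ nonColoops M (insert z B) := by rw [he]; exact Finset.mem_singleton_self e
      have heg : e ∈ gr M := hSg (mem_nonColoops.1 heN).1
      rw [he, rkN_eq_card_of_indep (by rw [Finset.coe_singleton]; exact hl e heg), Finset.card_singleton]
    unfold nonColoops at hsplit hN1'
    omega

open scoped Classical in
/-- **Every far set with a member carrying layer-2 weight has six elements** (any coloop count, `kColoops = 2`). -/
theorem card_eq_six_of_mem_ex2' (hs : ∀ e ∈ gr M, ∀ f ∈ gr M, e ≠ f → rkN M {e, f} = 2)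
    (hl : ∀ e ∈ gr M, M.Indep {e}) (hG : G ∈ flatsQ M (4 + 1)) (hd : (gr M \ G).card = 3) (hk : kColoops M G = 2)
    {B : Finset α} (hB : B ∈ ex2 M 4 G S) : S.card = 6 := by
  obtain ⟨z, hz, hloss⟩ := exists_loss_ne_zero_of_mem_ex2 hB
  obtain ⟨hBm, -, hBS, hsub, hcard⟩ := mem_ex2_unpack hB
  have h5 := card_eq_five_of_loss_ne_zero hs hl hG hd hk hBm (hsub hz) hloss
  have hzB : z ∉ B := (Finset.mem_sdiff.1 hz).2
  rw [Finset.card_insert_of_notMem hzB] at h5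
  have := Finset.card_sdiff_add_card_eq_card hBS
  omega

open scoped Classical in
/-- **A set `B' ⊇ K` whose complement in `G` lies in the closure of a member `B ⊇ K` is no member**: `ρ(G ∖ B') ≤ ρ(B) − |K| = 2`,
so `E ∖ B' ⊆ (G ∖ B') ∪ (E ∖ G)` has rank `≤ 5`. -/
theorem not_mem_Uq_of_sdiff_subset_clF (hG : G ∈ flatsQ M (4 + 1)) (hd : (gr M \ G).card = 3)
    (hk : kColoops M G = 2) {B : Finset α} (hBm : B ∈ membersIn M (Uq M (4 + 2) 4) G)
    (hKB : G.filter (fun y => y ∉ clF M (G.erase y)) ⊆ B) {B' : Finset α}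
    (hKB' : G.filter (fun y => y ∉ clF M (G.erase y)) ⊆ B') (hsub : G \ B' ⊆ clF M B) : B' ∉ Uq M (4 + 2) 4 := by
  set K := G.filter (fun y => y ∉ clF M (G.erase y)) with hKdef
  have hGg : G ⊆ gr M := (mem_flatsQ.1 hG).1
  have hBU : B ∈ Uq M (4 + 2) 4 := (mem_membersIn.1 hBm).1
  have hBcl : B ⊆ clF M B := subset_clF hBU
  have hrB : rkN M B = 4 := by
    have h := (mem_Uq.1 hBU).2.1
    rw [eRk_eq_rkN] at h
    exact_mod_cast h
  have hKc : K.card = 2 := by unfold kColoops at hk; rw [← hKdef] at hk; exact hk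
  set X := G \ B' with hXdef
  have hXG : X ⊆ G := Finset.sdiff_subset
  have hXK : Disjoint K X := by
    rw [Finset.disjoint_left]
    intro e heK heX
    exact (Finset.mem_sdiff.1 heX).2 (hKB' heK)
  have hKXcl : K ∪ X ⊆ clF M B := by
    intro e he
    rw [Finset.mem_union] at he
    rcases he with heK | heX
    · exact hBcl (hKB heK)
    · exact hsub heX
  have hrKX : rkN M (K ∪ X) ≤ 4 := by
    have := rkN_mono (M := M) hKXcl
    rwa [rkN_clF, hrB] at this
  have hY : ∀ y ∈ K, y ∈ G ∧ y ∉ clF M (G.erase y) := fun y hy => Finset.mem_filter.1 hy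
  have hrX : rkN M X ≤ 2 := by
    have h := eRk_union_coloops hGg K hY hXG hXK
    rw [eRk_eq_rkN, eRk_eq_rkN] at h
    have h' : rkN M (K ∪ X) = K.card + rkN M X := by exact_mod_cast h
    omega
  intro hmem
  have hr6 : rkN M (gr M \ B') = 6 := by
    have h := (mem_Uq.1 hmem).2.2
    rw [eRk_eq_rkN] at h
    exact_mod_cast h
  have hsub' : gr M \ B' ⊆ X ∪ (gr M \ G) := by
    intro e he
    rw [Finset.mem_sdiff] at he
    rw [Finset.mem_union, hXdef, Finset.mem_sdiff, Finset.mem_sdiff]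
    by_cases heG : e ∈ G
    · exact Or.inl ⟨heG, he.2⟩
    · exact Or.inr ⟨he.1, heG⟩
  have h1 : rkN M (gr M \ B') ≤ rkN M (X ∪ (gr M \ G)) := rkN_mono hsub'
  have h2 := rkN_inter_add_rkN_union_le (M := M) X (gr M \ G)
  have h3 : rkN M (gr M \ G) ≤ 3 := hd ▸ rkN_le_card _
  omega

/-- A member inside `G` with `|S ∖ B| = 2` leaves a point of `G` outside `S`: `|G ∖ B| ≥ 3`. -/
theorem exists_mem_sdiff_of_card_sdiff_eq_two (hG : G ∈ flatsQ M (4 + 1)) (hd : (gr M \ G).card = 3)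
    {B : Finset α} (hBm : B ∈ membersIn M (Uq M (4 + 2) 4) G) (hBS : B ⊆ S) (hSG : S ⊆ G)
    (hcard : (S \ B).card = 2) : ∃ p ∈ G, p ∉ S := by
  have hGg : G ⊆ gr M := (mem_flatsQ.1 hG).1
  have hBU : B ∈ Uq M (4 + 2) 4 := (mem_membersIn.1 hBm).1
  have hr6 : rkN M (gr M \ B) = 6 := by
    have h := (mem_Uq.1 hBU).2.2
    rw [eRk_eq_rkN] at h
    exact_mod_cast h
  have hsplit : gr M \ B = (G \ B) ∪ (gr M \ G) := by
    ext e
    simp only [Finset.mem_union, Finset.mem_sdiff]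
    constructor
    · rintro ⟨heE, heB⟩
      by_cases heG : e ∈ G
      · exact Or.inl ⟨heG, heB⟩
      · exact Or.inr ⟨heE, heG⟩
    · rintro (⟨heG, heB⟩ | ⟨heE, heG⟩)
      · exact ⟨hGg heG, heB⟩
      · exact ⟨heE, fun h => heG (hBS.trans hSG |> fun hs => hs h)⟩
  have h1 := rkN_le_card (M := M) (gr M \ B)
  rw [hsplit] at h1
  have h2 := Finset.card_union_le (G \ B) (gr M \ G)
  rw [hd] at h2
  have h3 : 3 ≤ (G \ B).card := by rw [hsplit] at hr6; omega
  by_contra hall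
  push Not at hall
  have : G \ B ⊆ S \ B := fun e he => Finset.mem_sdiff.2 ⟨hall e (Finset.mem_sdiff.1 he).1, (Finset.mem_sdiff.1 he).2⟩
  have := Finset.card_le_card this
  omega

open scoped Classical in
/-- **At most one pair member is fat** (`coloops S = K`, `|S| = 6`): two fat pair members `S ∖ P₁ ≠ S ∖ P₂` are either
complementary (then `S ∖ P₂ = K ∪ P₁` is no member, `not_mem_Uq_of_sdiff_subset_clF`) or share a point `t` of their pairs,
both lie in the independent `S ∖ t`, and a point of `G ∖ S` lands in `cl(K ∪ {s})` (`s` the fourth point). -/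
theorem not_two_fat_pairs (hs : ∀ e ∈ gr M, ∀ f ∈ gr M, e ≠ f → rkN M {e, f} = 2) (hG : G ∈ flatsQ M (4 + 1))
    (hd : (gr M \ G).card = 3) (hk : kColoops M G = 2) (hS : S ∈ shadowAt M (4 + 2) 4 (Uq M (4 + 2) 4) G)
    (hS6 : S.card = 6) (hcol : coloops M S = G.filter (fun y => y ∉ clF M (G.erase y))) {B₁ B₂ : Finset α}
    (hB₁ : B₁ ∈ membersIn M (Uq M (4 + 2) 4) G) (hB₂ : B₂ ∈ membersIn M (Uq M (4 + 2) 4) G)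
    (hK₁ : G.filter (fun y => y ∉ clF M (G.erase y)) ⊆ B₁) (hK₂ : G.filter (fun y => y ∉ clF M (G.erase y)) ⊆ B₂)
    (hB₁S : B₁ ⊆ S) (hB₂S : B₂ ⊆ S) (hc₁ : (S \ B₁).card = 2) (hc₂ : (S \ B₂).card = 2) (hne : B₁ ≠ B₂)
    (hf₁ : G \ S ⊆ clF M B₁) (hf₂ : G \ S ⊆ clF M B₂) : False := by
  set K := G.filter (fun y => y ∉ clF M (G.erase y)) with hKdef
  have hGg : G ⊆ gr M := (mem_flatsQ.1 hG).1
  have hSG : S ⊆ G := subset_of_mem_shadowAt hS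
  have hKc : K.card = 2 := by unfold kColoops at hk; rw [← hKdef] at hk; exact hk
  have hB₁U : B₁ ∈ Uq M (4 + 2) 4 := (mem_membersIn.1 hB₁).1
  have hB₂U : B₂ ∈ Uq M (4 + 2) 4 := (mem_membersIn.1 hB₂).1
  -- the pairs `P₁ = S ∖ B₁`, `P₂ = S ∖ B₂` lie in `S ∖ K`
  have hPK : ∀ e ∈ S \ B₁, e ∉ K := fun e he h => (Finset.mem_sdiff.1 he).2 (hK₁ h)
  have hPK' : ∀ e ∈ S \ B₂, e ∉ K := fun e he h => (Finset.mem_sdiff.1 he).2 (hK₂ h)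
  have hPne : S \ B₁ ≠ S \ B₂ := by
    intro h
    apply hne
    calc B₁ = S \ (S \ B₁) := (Finset.sdiff_sdiff_eq_self hB₁S).symm
      _ = S \ (S \ B₂) := by rw [h]
      _ = B₂ := Finset.sdiff_sdiff_eq_self hB₂S
  have hSK : S \ K ⊆ S := Finset.sdiff_subset
  have hSKc : (S \ K).card = 4 := by
    have := Finset.card_sdiff_add_card_eq_card (hcol ▸ coloops_subset_self (M := M) S : K ⊆ S)
    omega
  have hP₁ : S \ B₁ ⊆ S \ K := fun e he => Finset.mem_sdiff.2 ⟨(Finset.mem_sdiff.1 he).1, hPK e he⟩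
  have hP₂ : S \ B₂ ⊆ S \ K := fun e he => Finset.mem_sdiff.2 ⟨(Finset.mem_sdiff.1 he).1, hPK' e he⟩
  have hci := Finset.card_union_add_card_inter (S \ B₁) (S \ B₂)
  have hcu : ((S \ B₁) ∪ (S \ B₂)).card ≤ 4 := hSKc ▸ Finset.card_le_card (Finset.union_subset hP₁ hP₂)
  have hint2 : ((S \ B₁) ∩ (S \ B₂)).card ≤ 1 := by
    by_contra hlt
    push Not at hlt
    have heq : (S \ B₁) ∩ (S \ B₂) = S \ B₁ :=
      Finset.eq_of_subset_of_card_le Finset.inter_subset_left (by omega)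
    have heq' : (S \ B₁) ∩ (S \ B₂) = S \ B₂ :=
      Finset.eq_of_subset_of_card_le Finset.inter_subset_right (by omega)
    exact hPne (heq.symm.trans heq')
  by_cases hdisj : ((S \ B₁) ∩ (S \ B₂)).card = 0
  · -- complementary pairs: `B₂ = K ∪ P₁`, and `G ∖ B₂ = P₂ ∪ (G ∖ S) ⊆ cl B₁`
    have hunion : (S \ B₁) ∪ (S \ B₂) = S \ K :=
      Finset.eq_of_subset_of_card_le (Finset.union_subset hP₁ hP₂) (by omega)
    have hsub : G \ B₂ ⊆ clF M B₁ := by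
      intro e he
      rw [Finset.mem_sdiff] at he
      by_cases heS : e ∈ S
      · -- `e ∈ S ∖ B₂ ⊆ B₁`
        have heP₂ : e ∈ S \ B₂ := Finset.mem_sdiff.2 ⟨heS, he.2⟩
        have heB₁ : e ∈ B₁ := by
          by_contra h
          have : e ∈ (S \ B₁) ∩ (S \ B₂) := Finset.mem_inter.2 ⟨Finset.mem_sdiff.2 ⟨heS, h⟩, heP₂⟩
          rw [Finset.card_eq_zero] at hdisj
          rw [hdisj] at this
          exact Finset.notMem_empty _ this
        exact subset_clF hB₁U heB₁
      · exact hf₁ (Finset.mem_sdiff.2 ⟨he.1, heS⟩)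
    exact not_mem_Uq_of_sdiff_subset_clF hG hd hk hB₁ hK₁ hK₂ hsub hB₂U
  · -- the pairs share a point `t`
    have hint1 : ((S \ B₁) ∩ (S \ B₂)).card = 1 := by omega
    obtain ⟨t, ht⟩ := Finset.card_eq_one.1 hint1
    have htmem : t ∈ (S \ B₁) ∩ (S \ B₂) := by rw [ht]; exact Finset.mem_singleton_self t
    rw [Finset.mem_inter, Finset.mem_sdiff, Finset.mem_sdiff] at htmem
    have htK : t ∉ K := hPK t (Finset.mem_sdiff.2 htmem.1)
    have htc : t ∉ coloops M S := by rw [hcol]; exact htK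
    have hI : M.Indep ((S.erase t : Finset α) : Set α) := indep_erase_of_not_coloop hG hS hS6 htmem.1.1 htc
    have hB₁I : B₁ ⊆ S.erase t := fun e he => Finset.mem_erase.2 ⟨fun h => htmem.1.2 (h ▸ he), hB₁S he⟩
    have hB₂I : B₂ ⊆ S.erase t := fun e he => Finset.mem_erase.2 ⟨fun h => htmem.2.2 (h ▸ he), hB₂S he⟩
    -- the fourth point `s`: `B₁ ∩ B₂ = K ∪ {s}`
    have hu3 : ((S \ B₁) ∪ (S \ B₂)).card = 3 := by omega
    have hsc : ((S \ K) \ ((S \ B₁) ∪ (S \ B₂))).card = 1 := by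
      have := Finset.card_sdiff_add_card_eq_card (Finset.union_subset hP₁ hP₂)
      omega
    obtain ⟨s, hs'⟩ := Finset.card_eq_one.1 hsc
    have hsmem : s ∈ (S \ K) \ ((S \ B₁) ∪ (S \ B₂)) := by rw [hs']; exact Finset.mem_singleton_self s
    rw [Finset.mem_sdiff, Finset.mem_sdiff, Finset.mem_union, Finset.mem_sdiff, Finset.mem_sdiff, not_or] at hsmem
    have hsB₁ : s ∈ B₁ := by by_contra h; exact hsmem.2.1 ⟨hsmem.1.1, h⟩
    have hsB₂ : s ∈ B₂ := by by_contra h; exact hsmem.2.2 ⟨hsmem.1.1, h⟩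
    have hinter : B₁ ∩ B₂ = insert s K := by
      ext e
      rw [Finset.mem_inter, Finset.mem_insert]
      constructor
      · rintro ⟨he₁, he₂⟩
        by_cases heK : e ∈ K
        · exact Or.inr heK
        · left
          by_contra hes
          have heS : e ∈ S := hB₁S he₁
          have : e ∈ (S \ K) \ ((S \ B₁) ∪ (S \ B₂)) := by
            rw [Finset.mem_sdiff, Finset.mem_sdiff, Finset.mem_union, Finset.mem_sdiff, Finset.mem_sdiff, not_or]
            exact ⟨⟨heS, heK⟩, fun h => h.2 he₁, fun h => h.2 he₂⟩
          rw [hs', Finset.mem_singleton] at this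
          exact hes this
      · rintro (rfl | heK)
        · exact ⟨hsB₁, hsB₂⟩
        · exact ⟨hK₁ heK, hK₂ heK⟩
    obtain ⟨p, hpG, hpS⟩ := exists_mem_sdiff_of_card_sdiff_eq_two hG hd hB₁ hB₁S hSG hc₁
    have hp₁ : p ∈ clF M B₁ := hf₁ (Finset.mem_sdiff.2 ⟨hpG, hpS⟩)
    have hp₂ : p ∈ clF M B₂ := hf₂ (Finset.mem_sdiff.2 ⟨hpG, hpS⟩)
    have hpcl : p ∈ clF M (insert s K) := by
      rw [← hinter]; exact mem_clF_inter_of_indep hI hB₁I hB₂I hp₁ hp₂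
    have hpK : p ∉ K := fun h => hpS ((hcol ▸ coloops_subset_self (M := M) S : K ⊆ S) h)
    exact not_mem_clF_insert_K_of_ne hs hG hk (hSG hsmem.1.1) hsmem.1.2 hpG hpK (fun h => hpS (h ▸ hsmem.1.1)) hpcl

end TwoTwoA

end PercRepro.Shadow
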